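import Summits.AtomisticToContinuum.Crystallization.Theorems.ChargedEnergyGapZeroZoneSplit
import Summits.AtomisticToContinuum.Crystallization.Theorems.ChargedEnergyGapZeroConeCover
import Summits.AtomisticToContinuum.Crystallization.Theorems.ChargedEnergyGapPhiLogConcave
import Summits.AtomisticToContinuum.Crystallization.Theorems.ChargedEnergyGapCentreBox
import Summits.AtomisticToContinuum.Crystallization.Theorems.ChargedEnergyGapGridFrameA
import HarnessLib

/-!
# ChargedEnergyGap · ZeroHiEnclosure (decomp-a2c lens-5 g120, NODE 120 leaf G, THREE-ROW form) — line 14231, zone `zeroBox`, C ≥ 259/2: THE HIGH PART CLOSED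

Leaf G of NODE 120 («ZeroZoneSplit») in the three-row form that the PROVED cone cover `ZeroCone.zeroConeCover_tri` consumes: for every admissible tuple of
`zeroHiBox` (`C = dt 0 ∈ [259/2, 130.691]`, `ρ ∈ [0.679, 0.691]`, chart-realisable, positive, pole-ordered) and every axis `a`, with `m = φ(C − ρ)`,
`W = vtxW 160 dt 0`:  (i) `m ≤ W(a,T)` — 113C `centre_upper_of_chart` (`C ≤ T_a + ρ`) + `depthProfile_monotone`;  (ii) `W(a,T) ≤ W(a,F)` — pole order;
(iii) `W(a,T) + W(a,F) ≤ 21863/10000 · m` — 113M `sq_poles_le_of_chart` (`T_a² + F_a² ≤ 2(C² + ρ²)` ⇒ `T_a + F_a ≤ 2C + ρ²/C ≤ 2(C−ρ) + 1386/1000`),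
CONVEXITY of `φ` on `[80,134]` (NODE 97 `depthProfile_convexOn`, `chord_upper` twice: `φ(T)+φ(F) ≤ φ(x)+φ(x+1386/1000)`, `x = C − ρ`) and the
LOG-CONCAVITY ratio row of NODE 120-P at offset `1386/1000` (`φ(x + 1386/1000)·10⁴ ≤ 11863·φ(x)` for `x ≥ 128809/1000`; kernel end-row `ratioRow_S_end`).
ASSEMBLY (PROVED): ★★★ `zeroHiBoxLaw : 0 ≤ u → BoxLawP 130 u zeroHiBox` (G₃ + `ZeroCone.zeroConeCover_tri` + NODE 120 bridge pattern) and
★★★ `zeroBoxLaw_of_lo : 0 ≤ u → BoxLawP 130 u zeroLoBox → BoxLawP 130 u zeroBox` — the zone law of `zeroBox` now costs ONLY its low part `C ≤ 259/2`.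
0 sorry · imports = NODE 120 files (ZeroZoneSplit, ZeroConeCover, PhiLogConcave) + tree 113C/113M · no instance/notation/set_option/def. [g120]
-/

noncomputable section

namespace Summit.AtomisticToContinuum.Crystallization.Theorems.ChargedEnergyGapChartDial.ZeroZone
open Summit.AtomisticToContinuum.Crystallization.Theorems.ChargedEnergyGapChartDial

/-! ## §1 The pair-sum ratio row (offset `1386/1000 ≥ 2ρ + ρ²/C`) -/

/-- kernel end-row: `φ(128809/1000 + 1386/1000)·10⁴ ≤ 11863·φ(128809/1000)` (exact rational arithmetic on `qProf⁴`; margin ≈ 1.7e-5). -/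
theorem ratioRow_S_end : depthProfile 160 (128809 / 1000 + 1386 / 1000) * 10000 ≤ 11863 * depthProfile 160 (128809 / 1000) := by
  rw [depthProfile_eq_qProf_pow (by norm_num) (by norm_num), depthProfile_eq_qProf_pow (by norm_num) (by norm_num)]
  norm_num [qProf, sPoly]

/-- ★ the ratio row at offset `≤ 1386/1000` on `x ≥ 128809/1000` (log-concavity, NODE 120-P `depthProfile_ratio_upper`). -/
theorem ratioRow_S {x h : ℝ} (hx : 128809 / 1000 ≤ x) (hh : h ≤ 1386 / 1000) (hxh : x + 1386 / 1000 ≤ 160) :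
    depthProfile 160 (x + h) * 10000 ≤ 11863 * depthProfile 160 x := by
  have hmono : depthProfile 160 (x + h) ≤ depthProfile 160 (x + 1386 / 1000) := depthProfile_monotone (by norm_num) (by linarith)
  have hrat := depthProfile_ratio_upper (x₀ := 128809 / 1000) (x := x) (h := 1386 / 1000) (by norm_num) hx (by norm_num) hxh
  have hend := ratioRow_S_end
  have hφ0 : 0 < depthProfile 160 (128809 / 1000 : ℝ) := by
    rw [depthProfile_eq_qProf_pow (by norm_num) (by norm_num)]; exact pow_pos (qProf_pos (by norm_num) (by norm_num)) 4
  have hφx : 0 ≤ depthProfile 160 x := by unfold depthProfile; positivity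
  nlinarith [mul_le_mul_of_nonneg_right hrat (show (0:ℝ) ≤ 10000 by norm_num), mul_le_mul_of_nonneg_right hend hφx]

/-! ## §2 The pair-sum row via convexity of `φ` -/

/-- ★ CHORD STEP: for `x ≤ T ≤ F` with `T + F ≤ 2x + 1386/1000` (all in `[80,134]`): `φ(T) + φ(F) ≤ φ(x) + φ(x + 1386/1000)`
(two applications of NODE 97 `chord_upper` on `[x, x + 1386/1000]`; the slope is `≥ 0` by monotonicity). -/
theorem pair_sum_chord {x T F : ℝ} (hx0 : 80 ≤ x) (hx1 : x + 1386 / 1000 ≤ 134) (hxT : x ≤ T) (hTF : T ≤ F)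
    (hsum : T + F ≤ 2 * x + 1386 / 1000) :
    depthProfile 160 T + depthProfile 160 F ≤ depthProfile 160 x + depthProfile 160 (x + 1386 / 1000) := by
  have hxz : x < x + 1386 / 1000 := by linarith
  have hF : F ≤ x + 1386 / 1000 := by linarith
  have hT : T ≤ x + 1386 / 1000 := hTF.trans hF
  have hxs : x ∈ Set.Icc (80 : ℝ) 134 := ⟨hx0, by linarith⟩
  have hzs : x + 1386 / 1000 ∈ Set.Icc (80 : ℝ) 134 := ⟨by linarith, hx1⟩
  have h1 := chord_upper depthProfile_convexOn hxs hzs hxz hxT hT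
  have h2 := chord_upper depthProfile_convexOn hxs hzs hxz (hxT.trans hTF) hF
  have hd : x + 1386 / 1000 - x = 1386 / 1000 := by ring
  rw [hd] at h1 h2
  have hs : 0 ≤ (depthProfile 160 (x + 1386 / 1000) - depthProfile 160 x) / (1386 / 1000) :=
    div_nonneg (sub_nonneg.2 (depthProfile_monotone (by norm_num) hxz.le)) (by norm_num)
  have hlen : (T - x) + (F - x) ≤ 1386 / 1000 := by linarith
  have hmul := mul_le_mul_of_nonneg_left hlen hs
  have hkey : (depthProfile 160 (x + 1386 / 1000) - depthProfile 160 x) / (1386 / 1000) * (1386 / 1000) =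
      depthProfile 160 (x + 1386 / 1000) - depthProfile 160 x := div_mul_cancel₀ _ (by norm_num)
  nlinarith [h1, h2, hmul, hkey]

/-! ## §3 ★★ G₃ — the three-row enclosure of the high part -/

/-- ★★ **G₃ (PROVED)**: the `zeroHiBox` binder block implies the three rows consumed by `ZeroCone.zeroConeCover_tri`, with `m = φ(C − ρ)`. -/
theorem zeroHiEnclosure₃ :
    ∀ ρ : ℝ, (zeroHiBox.r0 : ℝ) ≤ ρ → ρ ≤ zeroHiBox.r1 → ∀ dt : (Fin 3 → ℤ) → ℝ,
      (zeroHiBox.t0 : ℝ) ≤ dt (holeVertex 0 (0, true)) → dt (holeVertex 0 (0, true)) ≤ zeroHiBox.t1 →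
      (zeroHiBox.f0 : ℝ) ≤ dt (holeVertex 0 (0, false)) → dt (holeVertex 0 (0, false)) ≤ zeroHiBox.f1 →
      (zeroHiBox.c0 : ℝ) ≤ dt 0 → dt 0 ≤ zeroHiBox.c1 →
      IsChartRealisable ρ dt → (∀ p ∈ stencil 0, 0 < dt p) → poleSum dt 0 ≤ poleSum dt 1 → poleSum dt 0 ≤ poleSum dt 2 →
      (∀ a : Fin 3, dt (holeVertex 0 (a, true)) ≤ dt (holeVertex 0 (a, false))) → IsTupleHole ((130 : ℚ) : ℝ) ρ dt →
      ∀ a : Fin 3, depthProfile 160 (dt 0 - ρ) ≤ vtxW 160 dt 0 (a, true) ∧ vtxW 160 dt 0 (a, true) ≤ vtxW 160 dt 0 (a, false) ∧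
        vtxW 160 dt 0 (a, true) + vtxW 160 dt 0 (a, false) ≤ 21863 / 10000 * depthProfile 160 (dt 0 - ρ) := by
  intro ρ e0 e1 dt _ _ _ _ c0 c1 hreal hpos _ _ hchp _ a
  simp only [vtxW]
  have hρ0 : (679 / 1000 : ℝ) ≤ ρ := le_trans (by norm_num [zeroHiBox]) e0
  have hρ1 : ρ ≤ 691 / 1000 := le_trans e1 (by norm_num [zeroHiBox])
  have hC0 : (259 / 2 : ℝ) ≤ dt 0 := le_trans (by norm_num [zeroHiBox]) c0
  have hC1 : dt 0 ≤ 130691 / 1000 := le_trans c1 (by norm_num [zeroHiBox])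
  have hT0 : 0 < dt (holeVertex 0 (a, true)) := hpos _ (mem_stencil_vertex 0 (a, true))
  have hxT : dt 0 - ρ ≤ dt (holeVertex 0 (a, true)) := by
    have := centre_upper_of_chart (by linarith) hreal (a, true) hT0.le; linarith
  have hTF : dt (holeVertex 0 (a, true)) ≤ dt (holeVertex 0 (a, false)) := hchp a
  have hmono := depthProfile_monotone (ϱ := 160) (by norm_num)
  refine ⟨hmono hxT, hmono hTF, ?_⟩
  -- the pair sum: T + F ≤ 2C + ρ²/C ≤ 2(C − ρ) + 1386/1000
  have hC : 0 < dt 0 := by linarith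
  have hsq := sq_poles_le_of_chart hreal a
  have h4 : (dt (holeVertex 0 (a, true)) + dt (holeVertex 0 (a, false))) ^ 2 ≤ 4 * (dt 0 ^ 2 + ρ ^ 2) := by
    nlinarith [sq_nonneg (dt (holeVertex 0 (a, true)) - dt (holeVertex 0 (a, false)))]
  have hB : 4 * (dt 0 ^ 2 + ρ ^ 2) ≤ (2 * dt 0 + ρ ^ 2 / dt 0) ^ 2 := by
    have e : (2 * dt 0 + ρ ^ 2 / dt 0) ^ 2 = 4 * (dt 0 ^ 2 + ρ ^ 2) + (ρ ^ 2 / dt 0) ^ 2 := by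
      field_simp; ring
    rw [e]; nlinarith [sq_nonneg (ρ ^ 2 / dt 0)]
  have hpos' : 0 ≤ 2 * dt 0 + ρ ^ 2 / dt 0 := by positivity
  have hle : dt (holeVertex 0 (a, true)) + dt (holeVertex 0 (a, false)) ≤ 2 * dt 0 + ρ ^ 2 / dt 0 :=
    (pow_le_pow_iff_left₀ (by linarith) hpos' two_ne_zero).1 (h4.trans hB)
  have hρC : ρ ^ 2 / dt 0 ≤ 4 / 1000 := by
    rw [div_le_iff₀ hC]; nlinarith
  have hsum : dt (holeVertex 0 (a, true)) + dt (holeVertex 0 (a, false)) ≤ 2 * (dt 0 - ρ) + 1386 / 1000 := by linarith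
  have hchord := pair_sum_chord (x := dt 0 - ρ) (by linarith) (by linarith) hxT hTF hsum
  have hrow := ratioRow_S (x := dt 0 - ρ) (h := 1386 / 1000) (by linarith) le_rfl (by linarith)
  linarith

/-! ## §4 ★★★ ASSEMBLY: the high part and the whole zone law of `zeroBox` -/

/-- ★★★ **THE HIGH-PART LAW (PROVED)**: `BoxLawP 130 u zeroHiBox` for every `u ≥ 0` — the roof vanishes on `C ≥ 259/2`. -/
theorem zeroHiBoxLaw {u : ℚ} (hu : 0 ≤ u) : BoxLawP 130 u zeroHiBox := by
  intro ρ e0 e1 dt t0 t1 f0 f1 c0 c1 hreal hpos hch1 hch2 hchp hhole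
  have hR := zeroHiEnclosure₃ ρ e0 e1 dt t0 t1 f0 f1 c0 c1 hreal hpos hch1 hch2 hchp hhole
  have hρ1 : ρ ≤ 691 / 1000 := le_trans e1 (by norm_num [zeroHiBox])
  have hρ0 : 0 ≤ ρ := le_trans (by norm_num [zeroHiBox]) e0
  have hC : (259 / 2 : ℝ) ≤ dt 0 := le_trans (by norm_num [zeroHiBox]) c0
  have h0 : roofVal T75 (vtxW 160 dt 0) ≤ 0 := ZeroCone.zeroConeCover_tri (scale_pos hρ1 hC) hR
  have hc := feetHoleCost_le_of_roofVal_le (ϱ := 160) (τ := 3 / 100) (by norm_num) hρ0 le_rfl h0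
  have hcap := domCapK_nonneg (show (0 : ℝ) ≤ (u : ℝ) by exact_mod_cast hu) 160 (3 / 100) ρ (chargeDepth ρ dt 0)
  rw [mul_zero] at hc
  exact hc.trans hcap

/-- ★★★ **NODE 120 ASSEMBLED**: the zone law `LAW⁺(zeroBox, u)` from its LOW part (`C ≤ 259/2`, stations / priced certificates) ALONE. -/
theorem zeroBoxLaw_of_lo {u : ℚ} (hu : 0 ≤ u) (hlo : BoxLawP 130 u zeroLoBox) : BoxLawP 130 u zeroBox :=
  zeroBoxLaw_of_split hlo (zeroHiBoxLaw hu)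

/-- NODE 120's typed leaves K and G are no longer needed as hypotheses: `zeroBox_hzone`'s conclusion from the low part. -/
theorem zeroBox_hzone_of_lo (hlo : BoxLawP 130 (1 / 60000000) zeroLoBox) : BoxLawP 130 (1 / 60000000) zeroBox :=
  zeroBoxLaw_of_lo (by norm_num) hlo

end Summit.AtomisticToContinuum.Crystallization.Theorems.ChargedEnergyGapChartDial.ZeroZone

end
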